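import Summits.HodgeConjecture.HodgeConjecture.Theorems.BoundaryReadoutPullbackAlgebraicSectionReadout
import Literature.AlgebraicTopology.CharacteristicClasses.ProjectiveSpaceLerayHirsch
import HarnessLib

/-!
# Crux `PullbackAlgebraic` (stmt-HodgeConjecture-1071), line `normal_cone`: stub 3d
# `stub_lerayHirschReadout` — the coefficients of an algebraic class in a divisor-power expansion are algebraic

Route `BoundaryReadout` / `QbarEnvelope` of `HodgeConjecture`, crux `PullbackAlgebraic`
(stmt-HodgeConjecture-1071), ACTIVE skeleton `Cruxes/PullbackAlgebraic/Lines/normal_cone.lean`, registered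
stub `stub_lerayHirschReadout` (Fulton 1998, Thm. 3.3 (b) "Gysin for bundles"; Voisin I, Lemma 7.32, run
on the coniveau carrier): for `q : E → X` between smooth projective complex varieties
(`dim E = dim X + r`) such that `q^*` preserves the support filtration, a divisor class `ζ ∈ N¹ H²(E)`
with `q_*(ζʳ) = c · 1`, `c ≠ 0`, and classes `x_b ∈ H^{2p-2b}(X)` (`b ≤ min r p`): if
`Σ_b ζᵇ ∪ q^* x_b ∈ Nᵖ H²ᵖ(E)` then every `x_b ∈ Nᵖ⁻ᵇ H²ᵖ⁻²ᵇ(X)`.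

This is the registered signature VERBATIM, proved by the landed extraction theorem
`lerayHirschCoeff_mem_algebraicClasses` (`Theorems/BoundaryReadoutPullbackAlgebraicSectionReadout`,
p167400): the two spellings differ only by the order of the cup factors (even degrees, so graded
commutativity `cupProduct_gradedComm_holds` has sign `+1`) and by the name of the cup powers
(`CharacteristicClasses.cupPow` versus `cupPowTwo`, the same recursion: `cupPow_eq_cupPowTwo`). The
hypothesis "`Nˡ ∪ N¹ ⊆ Nˡ⁺¹` on every smooth projective variety" of the stub is not needed (it is the
tree's theorem `stub_cupProductAlgebraicDivisor`, used inside the extraction theorem).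

## References

* [Fulton1998] W. Fulton, Intersection Theory, 2nd ed. (1998), Thm. 3.3 (b), Prop. 3.1 (a), §3.3.
* [VoisinHodgeI2002] C. Voisin, Hodge Theory and Complex Algebraic Geometry I (2002), Lemma 7.32.
* [HatcherAT2002] A. Hatcher, Algebraic Topology (2002), §3.2 Thm. 3.11 (graded commutativity).
-/

noncomputable section

-- every declaration of this problem lives in `Summit.HodgeConjecture.HodgeConjecture.…` (summit = sub-problem)
set_option linter.dupNamespace false

open CategoryTheory AlgebraicGeometry MonoidalCategory CartesianMonoidalCategory
open Literature.AlgebraicTopology.SingularHomology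
open Literature.AlgebraicTopology.CharacteristicClasses (cupPow cupPow_zero cupPow_succ)
open Literature.AlgebraicGeometry Literature.AlgebraicGeometry.Motives Literature.AlgebraicGeometry.HodgeTheory

namespace Summit.HodgeConjecture.HodgeConjecture.Theorems.PullbackAlgebraicNormalCone

/-- The two cup-power recursions of the tree agree: `CharacteristicClasses.cupPow ℂ x j = cupPowTwo x j`
(both are `x⁰ = 1`, `xʲ⁺¹ = xʲ ∪ x`). [cite: HatcherAT2002, §3.2 p. 212] -/
theorem cupPow_eq_cupPowTwo {Y : Type} [TopologicalSpace Y] (x : singularCohomology ℂ ℂ Y 2) :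
    ∀ j : ℕ, cupPow ℂ x j = cupPowTwo x j
  | 0 => rfl
  | j + 1 => by rw [cupPow_succ, cupPowTwo_succ, cupPow_eq_cupPowTwo x j]

/-- **Stub 3d of line `normal_cone` — Leray–Hirsch readout: the coefficients of an algebraic class are
algebraic** (Fulton 1998, Thm. 3.3 (b) / Prop. 3.1; Voisin I Lemma 7.32, on the coniveau carrier). For
`q : E → X` between smooth projective varieties (`dim E = dim X + r`) such that `q^*` preserves the
support filtration, granted `Nˡ ∪ N¹ ⊆ Nˡ⁺¹` on every smooth projective variety (not used: it is a
theorem of the tree), a class `ζ ∈ N¹ H²(E)` with `q_*(ζʳ) = c · 1`, `c ≠ 0`, and classes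
`x_b ∈ H^{2p-2b}(X)`, `b ≤ min r p`: if `Σ_b ζᵇ ∪ q^* x_b ∈ Nᵖ H²ᵖ(E)` then every
`x_b ∈ N^{p-b} H^{2p-2b}(X)`. Proof: reorder the cup factors (even degrees) and apply the landed
top-down Gysin extraction `lerayHirschCoeff_mem_algebraicClasses`.
[cite: Fulton1998, Thm. 3.3 (b) and Prop. 3.1 (a)] [cite: VoisinHodgeI2002, Lemma 7.32] -/
theorem stub_lerayHirschReadout :
    ∀ (μ : OrientationFamily) ⦃n r : ℕ⦄ ⦃X E : SchemeOver ℂ⦄ (q : E ⟶ X)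
      (hX : IsSmoothProjective n X) (hE : IsSmoothProjective (n + r) E),
      (∀ (k c : ℕ), ∀ x ∈ supportedClasses X k c, complexBetti.map q k x ∈ supportedClasses E k c) →
      (∀ ⦃m : ℕ⦄ ⦃Y : SchemeOver ℂ⦄, IsSmoothProjective m Y → ∀ (l : ℕ) (a : complexBetti Y (2 * l))
        (d : complexBetti Y (2 * 1)), a ∈ algebraicClasses Y l → d ∈ algebraicClasses Y 1 →
        cupProduct (show 2 * l + 2 * 1 = 2 * (l + 1) by omega) a d ∈ algebraicClasses Y (l + 1)) →
      ∀ (ζ : complexBetti E (2 * 1)), ζ ∈ algebraicClasses E 1 → ∀ (c : ℂ), c ≠ 0 →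
        complexGysin μ hE hX q (show 2 * r + 2 * n = 0 + 2 * (n + r) by omega)
            (Literature.AlgebraicTopology.CharacteristicClasses.cupPow ℂ ζ r) =
          c • Literature.AlgebraicTopology.SingularHomology.singularCohomology.one ℂ
            (Motives.ComplexPoints X) →
        ∀ (p : ℕ) (x : (b : Fin (min r p + 1)) → complexBetti X (2 * (p - (b : ℕ)))),
          (∑ b : Fin (min r p + 1),
              cupProduct (show 2 * (b : ℕ) + 2 * (p - (b : ℕ)) = 2 * p by omega)
                (Literature.AlgebraicTopology.CharacteristicClasses.cupPow ℂ ζ b)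
                (complexBetti.map q (2 * (p - (b : ℕ))) (x b))) ∈ algebraicClasses E p →
          ∀ b : Fin (min r p + 1), x b ∈ algebraicClasses X (p - (b : ℕ)) := by
  intro μ n r X E q hX hE hflat _ ζ hζ c hc hgys p x hy b
  have hBp : min r p + 1 ≤ p + 1 := by omega
  -- reorder the cup factors and rename the powers
  have e : (∑ b : Fin (min r p + 1),
      cupProduct (show 2 * (b : ℕ) + 2 * (p - (b : ℕ)) = 2 * p by omega)
        (cupPow ℂ ζ b) (complexBetti.map q (2 * (p - (b : ℕ))) (x b))) =
      ∑ b : Fin (min r p + 1), cupProduct (Theorems.two_mul_sub_add p hBp b)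
        (complexBetti.map q (2 * (p - (b : ℕ))) (x b)) (cupPowTwo ζ b) := by
    refine Finset.sum_congr rfl fun b _ ↦ ?_
    rw [cupProduct_gradedComm_holds ℂ (Motives.ComplexPoints E)
        (show 2 * (b : ℕ) + 2 * (p - (b : ℕ)) = 2 * p by omega) (Theorems.two_mul_sub_add p hBp b),
      cupPow_eq_cupPowTwo,
      show ((-1 : ℂ) ^ (2 * (b : ℕ) * (2 * (p - (b : ℕ))))) = 1 from
        Even.neg_one_pow ⟨(b : ℕ) * (2 * (p - (b : ℕ))), by ring⟩, one_smul]
  rw [e] at hy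
  rw [cupPow_eq_cupPowTwo] at hgys
  exact Theorems.lerayHirschCoeff_mem_algebraicClasses μ hX hE q hζ
    (fun c' x' hx' ↦ hflat _ _ x' hx') hc hgys hBp (by omega) x hy b

end Summit.HodgeConjecture.HodgeConjecture.Theorems.PullbackAlgebraicNormalCone

end
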